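import Literature.NumberTheory.EllipticCurves.NeronLocalHeightTateLemma
import HarnessLib

/-!
# Tate's Lemma VI.1.2 in every characteristic, and the duplication formula for Néron's `λ_v`

Topic `NumberTheory/EllipticCurves` (family `abc`, G06; also `bsd`). This file **discharges** the two
named facts of `Literature.NumberTheory.EllipticCurves.NeronLocalHeight` (D-0014):

* `WeierstrassCurve.Affine.Point.tateCorrection_bounded_holds` — Silverman, *Advanced Topics in the
  Arithmetic of Elliptic Curves* (ATAEC), **Lemma VI.1.2** (p. 457): for an elliptic curve `W` over
  *any* field `K` and *any* absolute value `v` on `K`, Tate's correction term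
  `f(P) = ½ log (max{|φ(x)|ᵥ, |ψ(x)|ᵥ} / max{|x|ᵥ⁴, 1}) − ¼ log|Δ|ᵥ` is bounded on `E(K)`;
* `WeierstrassCurve.Affine.Point.neronLocalHeight_two_nsmul_holds` — ATAEC **Thm. VI.1.1(a)(iii)**
  (p. 455, proof p. 458): `λ([2]P) = 4λ(P) + v((2y + a₁x + a₃)(P)) − ¼ v(Δ)` whenever `[2]P ≠ O`,
  obtained from the first through the tree's `neronLocalHeight_two_nsmul_of` (Tate's telescoping
  identity `4μ − μ∘[2] = f`, ATAEC Prop. VI.1.3, and `x(2P) = φ/ψ`).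

The sibling file `NeronLocalHeightTateLemma` proves Lemma VI.1.2 only when `2 ≠ 0` in `K` (its Bézout
identity `Uφ + Vψ = 64Δ²` degenerates in characteristic `2`). Here the characteristic is arbitrary.

## Proof of Lemma VI.1.2 (all characteristics)

ATAEC p. 457 argues: `φ = X⁴ − b₄X² − 2b₆X − b₈` and `ψ = 4X³ + b₂X² + 2b₄X + b₆` are relatively
prime ("Proof 2 (computational): `Resultant(φ, ψ) = Δ²`"), so `φΦ + ψΨ = 1` for some `Φ, Ψ ∈ K[X]`,
and the triangle inequality bounds `max{|φ|, |ψ|}` below on `|x| ≤ c₁`, while for `|x|` large the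
quotient tends to `1`. We run this argument with an explicit certificate valid over `ℤ[a₁,…,a₆][Δ⁻¹]`,
already in Mathlib: M. Stoll's `WeierstrassCurve.addSubMapCoeff_condition` states that for the
addition–subtraction map `A = (A₀ : A₁ : A₂)` on `ℙ²` (`WeierstrassCurve.addSubMap`) there are
quadratic forms `q_{ij}` with `Σ_j q_{ij}(s,t,u) A_j(s,t,u) = sᵢ⁴` (`i = 0, 1, 2`). On the diagonal
`(s : t : u) = (x² : 2x : 1)` (the pair `(P, P)`) one has `A₀ = φ(x)`, `A₁ = ψ(x)`, `A₂ = 0`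
(`eval_addSubMap_zero_diag` etc.), whence the two identities
`x⁸ = q₀₀ φ(x) + q₀₁ ψ(x)` and `1 = q₂₀ φ(x) + q₂₁ ψ(x)` (`addSubMapCoeff_condition_diag_zero/two`) —
the analogues of AEC VIII.4 Sublemma 4.3 for a general Weierstrass equation. Mathlib's local estimate
`AbsoluteValue.eval_mvPolynomial_le` (`|q(y)|ᵥ ≤ S_q ‖y‖ᵥ²`) and `‖(x², 2x, 1)‖ᵥ ≤ 2 max{|x|ᵥ, 1}²`
then give `max{|x|ᵥ, 1}⁸ ≤ S max{|x|ᵥ,1}⁴ max{|φ(x)|ᵥ, |ψ(x)|ᵥ}`, i.e. the lower bound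
`max{|φ|,|ψ|}/max{|x|⁴,1} ≥ 1/S` in one stroke (both regimes of the printed proof); the upper bound
is the triangle inequality (`abv_eval_Φ_two_le`, `abv_eval_Ψ₂Sq_le` of the sibling file).

## Contents

* `Literature.NumberTheory.EllipticCurves.eval_addSubMap_{zero,one,two}_diag`,
  `addSubMapCoeff_condition_diag_{zero,two}` — Stoll's certificate on the diagonal (any ring);
* `iSup_abv_diag_le`, `exists_abv_eval_diag_le`, `exists_pos_mul_le_max_abv_duplication`,
  `exists_duplication_quotient_bounds` — the local estimates for an arbitrary absolute value;
* `WeierstrassCurve.Affine.Point.tateCorrection_bounded_holds`, `neronLocalHeight_two_nsmul_holds`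
  (the discharges) and the unconditional forms `summable_tateMu`,
  `four_mul_tateMu_sub_tateMu_two_nsmul`, `exists_abs_tateCorrection_le`,
  `exists_abs_neronLocalHeight_sub_naiveLocalHeight_le`, `neronLocalHeight_two_nsmul_eq` of the
  conditional API of `NeronLocalHeight.lean` (deliberate dot-notation extensions of Mathlib's
  `WeierstrassCurve.Affine.Point`, as there).

## References

* J. H. Silverman, *Advanced Topics in the Arithmetic of Elliptic Curves*, GTM 151 (1994), Ch. VI §1:
  Thm. 1.1 (p. 455), Lemma 1.2 (p. 457), Prop. 1.3 (pp. 457–458), end of the proof of Thm. 1.1 (p. 458).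
* J. H. Silverman, *The Arithmetic of Elliptic Curves*, 2nd ed. (2009), VIII.4, Sublemma 4.3.
* M. Stoll, `Mathlib.AlgebraicGeometry.EllipticCurve.Affine.AddSubMap`,
  `Mathlib.NumberTheory.Height.MvPolynomial` (2026).
-/

noncomputable section

open scoped Classical

open Polynomial

namespace Literature.NumberTheory.EllipticCurves

open WeierstrassCurve.Affine.Point (eval_Φ_two eval_Ψ₂Sq abv_eval_Φ_two_le abv_eval_Ψ₂Sq_le)

/-! ### Stoll's certificate on the diagonal `(x² : 2x : 1)` -/

section Certificate

variable {R : Type*} [CommRing R] (W : WeierstrassCurve R)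

/-- On the diagonal `(s : t : u) = (x² : 2x : 1)` (the symmetric square of `(x : 1)`), coordinate `0`
of Stoll's addition–subtraction map `WeierstrassCurve.addSubMap` is the duplication numerator
`φ(x) = x⁴ − b₄x² − 2b₆x − b₈` (Mathlib's `W.Φ 2`). [folklore] -/
theorem eval_addSubMap_zero_diag (x : R) :
    (W.addSubMap 0).eval ![x ^ 2, 2 * x, 1] = (W.Φ 2).eval x := by
  rw [eval_Φ_two]
  simp [WeierstrassCurve.addSubMap]
  ring

/-- On the diagonal `(x² : 2x : 1)`, coordinate `1` of the addition–subtraction map is the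
duplication denominator `ψ(x) = 4x³ + b₂x² + 2b₄x + b₆` (Mathlib's `W.Ψ₂Sq`). [folklore] -/
theorem eval_addSubMap_one_diag (x : R) :
    (W.addSubMap 1).eval ![x ^ 2, 2 * x, 1] = W.Ψ₂Sq.eval x := by
  rw [eval_Ψ₂Sq]
  simp [WeierstrassCurve.addSubMap]
  ring

/-- On the diagonal `(x² : 2x : 1)`, coordinate `2` of the addition–subtraction map vanishes
(`x(P − P) = x(O) = ∞`). [folklore] -/
theorem eval_addSubMap_two_diag (x : R) :
    (W.addSubMap 2).eval ![x ^ 2, 2 * x, 1] = 0 := by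
  simp [WeierstrassCurve.addSubMap]
  ring

variable [W.IsElliptic]

/-- **Stoll's certificate on the diagonal, `i = 0`**: with `q_{0j} = Δ⁻¹ · addSubMapCoeff (0, j)`
(quadratic forms in `(s, t, u)` with coefficients in `ℤ[b₂, b₄, b₆, b₈][Δ⁻¹]`),
`q₀₀(x², 2x, 1) · φ(x) + q₀₁(x², 2x, 1) · ψ(x) = x⁸` — the general-Weierstrass analogue of
`f₂φ − g₂ψ = 4Δ X⁷` in AEC VIII.4, Sublemma 4.3 (there for `y² = x³ + Ax + B`); a specialisation
of Mathlib's `WeierstrassCurve.addSubMapCoeff_condition`. [folklore] -/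
theorem addSubMapCoeff_condition_diag_zero (x : R) :
    (MvPolynomial.C (↑W.Δ'⁻¹ : R) * W.addSubMapCoeff (0, 0)).eval ![x ^ 2, 2 * x, 1] *
        (W.Φ 2).eval x +
      (MvPolynomial.C (↑W.Δ'⁻¹ : R) * W.addSubMapCoeff (0, 1)).eval ![x ^ 2, 2 * x, 1] *
        W.Ψ₂Sq.eval x = x ^ 8 := by
  have h := W.addSubMapCoeff_condition (![x ^ 2, 2 * x, 1] : Fin 3 → R) 0
  have h0 : (![x ^ 2, 2 * x, 1] : Fin 3 → R) 0 = x ^ 2 := rfl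
  rw [Fin.sum_univ_three, eval_addSubMap_zero_diag, eval_addSubMap_one_diag,
    eval_addSubMap_two_diag, h0] at h
  linear_combination h

/-- **Stoll's certificate on the diagonal, `i = 2`**:
`q₂₀(x², 2x, 1) · φ(x) + q₂₁(x², 2x, 1) · ψ(x) = 1` — the general-Weierstrass analogue of
`f₁φ − g₁ψ = 4Δ` in AEC VIII.4, Sublemma 4.3; in particular `φ` and `ψ` generate the unit ideal of
`K[X]` in every characteristic (ATAEC p. 457: "`φ(x)` and `ψ(x)` are relatively prime"); a
specialisation of Mathlib's `WeierstrassCurve.addSubMapCoeff_condition`. [folklore] -/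
theorem addSubMapCoeff_condition_diag_two (x : R) :
    (MvPolynomial.C (↑W.Δ'⁻¹ : R) * W.addSubMapCoeff (2, 0)).eval ![x ^ 2, 2 * x, 1] *
        (W.Φ 2).eval x +
      (MvPolynomial.C (↑W.Δ'⁻¹ : R) * W.addSubMapCoeff (2, 1)).eval ![x ^ 2, 2 * x, 1] *
        W.Ψ₂Sq.eval x = 1 := by
  have h := W.addSubMapCoeff_condition (![x ^ 2, 2 * x, 1] : Fin 3 → R) 2
  have h2 : (![x ^ 2, 2 * x, 1] : Fin 3 → R) 2 = 1 := rfl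
  rw [Fin.sum_univ_three, eval_addSubMap_zero_diag, eval_addSubMap_one_diag,
    eval_addSubMap_two_diag, h2] at h
  linear_combination h

end Certificate

/-! ### Local estimates for an arbitrary absolute value -/

section Estimates

variable {K : Type*} [Field K] (v : AbsoluteValue K ℝ) (W : WeierstrassCurve K)

/-- `‖(x², 2x, 1)‖ᵥ ≤ 2 max{|x|ᵥ, 1}²` (since `|2|ᵥ ≤ 2`). [folklore] -/
theorem iSup_abv_diag_le (x : K) :
    ⨆ i, v ((![x ^ 2, 2 * x, 1] : Fin 3 → K) i) ≤ 2 * max (v x) 1 ^ 2 := by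
  set m := max (v x) 1 with hm
  have hm1 : 1 ≤ m := le_max_right _ _
  have hxm : v x ≤ m := le_max_left _ _
  have hx0 : 0 ≤ v x := v.nonneg x
  have h2 : v 2 ≤ 2 := by
    calc v 2 = v (1 + 1) := by norm_num
      _ ≤ v 1 + v 1 := v.add_le 1 1
      _ = 2 := by rw [v.map_one]; norm_num
  have hx2 : v x ^ 2 ≤ m ^ 2 := pow_le_pow_left₀ hx0 hxm 2
  refine ciSup_le fun i => ?_
  fin_cases i
  · show v (x ^ 2) ≤ 2 * m ^ 2
    rw [v.map_pow]
    nlinarith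
  · show v (2 * x) ≤ 2 * m ^ 2
    rw [v.map_mul]
    calc v 2 * v x ≤ 2 * m := mul_le_mul h2 hxm hx0 zero_le_two
      _ ≤ 2 * m ^ 2 := by nlinarith
  · show v 1 ≤ 2 * m ^ 2
    rw [v.map_one]
    nlinarith

/-- A quadratic form `q(s, t, u)` is `O(max{|x|ᵥ, 1}⁴)` on the diagonal `(x², 2x, 1)`:
`|q(x², 2x, 1)|ᵥ ≤ S · max{|x|ᵥ, 1}⁴` with `S = 4 Σ |coefficients|ᵥ` (Mathlib's local estimate
`AbsoluteValue.eval_mvPolynomial_le`). [folklore] -/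
theorem exists_abv_eval_diag_le {q : MvPolynomial (Fin 3) K} (hq : q.IsHomogeneous 2) :
    ∃ S : ℝ, 0 ≤ S ∧ ∀ x : K, v (q.eval ![x ^ 2, 2 * x, 1]) ≤ S * max (v x) 1 ^ 4 := by
  obtain ⟨T, hT⟩ : ∃ T : ℝ, ∀ y : Fin 3 → K, v (q.eval y) ≤ T * (⨆ i, v (y i)) ^ 2 :=
    ⟨_, fun y => v.eval_mvPolynomial_le hq y⟩
  refine ⟨4 * max T 0, by positivity, fun x => ?_⟩
  have hsup0 : 0 ≤ ⨆ i, v ((![x ^ 2, 2 * x, 1] : Fin 3 → K) i) :=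
    Real.iSup_nonneg fun i => v.nonneg _
  have hsup := iSup_abv_diag_le v x
  calc v (q.eval ![x ^ 2, 2 * x, 1])
      ≤ T * (⨆ i, v ((![x ^ 2, 2 * x, 1] : Fin 3 → K) i)) ^ 2 := hT _
    _ ≤ max T 0 * (⨆ i, v ((![x ^ 2, 2 * x, 1] : Fin 3 → K) i)) ^ 2 :=
        mul_le_mul_of_nonneg_right (le_max_left _ _) (by positivity)
    _ ≤ max T 0 * (2 * max (v x) 1 ^ 2) ^ 2 :=
        mul_le_mul_of_nonneg_left (pow_le_pow_left₀ hsup0 hsup 2) (le_max_right _ _)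
    _ = 4 * max T 0 * max (v x) 1 ^ 4 := by ring

/-- **Lower bound for the duplication polynomials in every characteristic**: for an elliptic curve
`W` over a field `K` and any absolute value `v` there is `c > 0` with
`c · max{|x|ᵥ, 1}⁴ ≤ max{|φ(x)|ᵥ, |ψ(x)|ᵥ}` for all `x ∈ K` (ATAEC, proof of Lemma VI.1.2:
`F ≥ ½` for `|x|` large and `max{|φ|, |ψ|} ≥ c₂` for `|x| ≤ c₁`; here both at once from the
certificate identities `x⁸ = q₀₀φ + q₀₁ψ`, `1 = q₂₀φ + q₂₁ψ`). [cite: Silverman1994, Lemma VI.1.2] -/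
theorem exists_pos_mul_le_max_abv_duplication [W.IsElliptic] :
    ∃ c : ℝ, 0 < c ∧ ∀ x : K,
      c * max (v x) 1 ^ 4 ≤ max (v ((W.Φ 2).eval x)) (v (W.Ψ₂Sq.eval x)) := by
  have hq : ∀ ij, (MvPolynomial.C (↑W.Δ'⁻¹ : K) * W.addSubMapCoeff ij).IsHomogeneous 2 :=
    fun ij => (W.isHomogeneous_addSubMapCoeff ij).C_mul _
  obtain ⟨S₀₀, hS₀₀0, hS₀₀⟩ := exists_abv_eval_diag_le v (hq (0, 0))
  obtain ⟨S₀₁, hS₀₁0, hS₀₁⟩ := exists_abv_eval_diag_le v (hq (0, 1))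
  obtain ⟨S₂₀, hS₂₀0, hS₂₀⟩ := exists_abv_eval_diag_le v (hq (2, 0))
  obtain ⟨S₂₁, hS₂₁0, hS₂₁⟩ := exists_abv_eval_diag_le v (hq (2, 1))
  refine ⟨1 / (S₀₀ + S₀₁ + S₂₀ + S₂₁ + 1), by positivity, fun x => ?_⟩
  have b₀₀ := hS₀₀ x
  have b₀₁ := hS₀₁ x
  have b₂₀ := hS₂₀ x
  have b₂₁ := hS₂₁ x
  have hid8 := addSubMapCoeff_condition_diag_zero W x
  have hid1 := addSubMapCoeff_condition_diag_two W x
  set y : Fin 3 → K := ![x ^ 2, 2 * x, 1] with hy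
  set q₀₀ := (MvPolynomial.C (↑W.Δ'⁻¹ : K) * W.addSubMapCoeff (0, 0)).eval y
  set q₀₁ := (MvPolynomial.C (↑W.Δ'⁻¹ : K) * W.addSubMapCoeff (0, 1)).eval y
  set q₂₀ := (MvPolynomial.C (↑W.Δ'⁻¹ : K) * W.addSubMapCoeff (2, 0)).eval y
  set q₂₁ := (MvPolynomial.C (↑W.Δ'⁻¹ : K) * W.addSubMapCoeff (2, 1)).eval y
  set φ := (W.Φ 2).eval x
  set ψ := W.Ψ₂Sq.eval x
  set m := max (v x) 1 with hm
  set M := max (v φ) (v ψ) with hM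
  have hm1 : 1 ≤ m := le_max_right _ _
  have hm0 : 0 < m := by positivity
  have hM0 : 0 ≤ M := le_max_of_le_left (v.nonneg _)
  have hφM : v φ ≤ M := le_max_left _ _
  have hψM : v ψ ≤ M := le_max_right _ _
  -- `|x|⁸ ≤ (S₀₀ + S₀₁) m⁴ M` and `1 ≤ (S₂₀ + S₂₁) m⁴ M`
  have h8 : v x ^ 8 ≤ (S₀₀ + S₀₁) * m ^ 4 * M := by
    calc v x ^ 8 = v (q₀₀ * φ + q₀₁ * ψ) := by rw [hid8, v.map_pow]
      _ ≤ v q₀₀ * v φ + v q₀₁ * v ψ := by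
          rw [← v.map_mul, ← v.map_mul]
          exact v.add_le _ _
      _ ≤ S₀₀ * m ^ 4 * M + S₀₁ * m ^ 4 * M := by gcongr
      _ = (S₀₀ + S₀₁) * m ^ 4 * M := by ring
  have h1 : (1 : ℝ) ≤ (S₂₀ + S₂₁) * m ^ 4 * M := by
    calc (1 : ℝ) = v (q₂₀ * φ + q₂₁ * ψ) := by rw [hid1, v.map_one]
      _ ≤ v q₂₀ * v φ + v q₂₁ * v ψ := by
          rw [← v.map_mul, ← v.map_mul]
          exact v.add_le _ _
      _ ≤ S₂₀ * m ^ 4 * M + S₂₁ * m ^ 4 * M := by gcongr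
      _ = (S₂₀ + S₂₁) * m ^ 4 * M := by ring
  -- hence `m⁸ ≤ S m⁴ M` with `S = S₀₀ + S₀₁ + S₂₀ + S₂₁`
  have hm4M : 0 ≤ m ^ 4 * M := by positivity
  have hm8 : m ^ 8 ≤ (S₀₀ + S₀₁ + S₂₀ + S₂₁) * m ^ 4 * M := by
    rcases le_total (v x) 1 with hx | hx
    · have hm1' : m = 1 := by rw [hm]; exact max_eq_right hx
      have : m ^ 8 = 1 := by rw [hm1', one_pow]
      nlinarith
    · have hmx : m = v x := by rw [hm]; exact max_eq_left hx
      have : m ^ 8 = v x ^ 8 := by rw [hmx]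
      nlinarith
  -- divide by `m⁴ > 0`
  have hm4pos : 0 < m ^ 4 := by positivity
  have hm4 : m ^ 4 ≤ (S₀₀ + S₀₁ + S₂₀ + S₂₁) * M := by
    have h' : m ^ 4 * m ^ 4 ≤ (S₀₀ + S₀₁ + S₂₀ + S₂₁) * M * m ^ 4 := by
      calc m ^ 4 * m ^ 4 = m ^ 8 := by ring
        _ ≤ (S₀₀ + S₀₁ + S₂₀ + S₂₁) * m ^ 4 * M := hm8
        _ = (S₀₀ + S₀₁ + S₂₀ + S₂₁) * M * m ^ 4 := by ring
    exact le_of_mul_le_mul_right h' hm4pos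
  rw [div_mul_eq_mul_div, one_mul, div_le_iff₀ (by positivity)]
  nlinarith

/-- **Two-sided bound for the duplication quotient, every characteristic**: for an elliptic curve
over any field and any absolute value `v` there are constants `0 < c₁ ≤ c₂` with
`c₁ ≤ max{|φ(x)|ᵥ, |ψ(x)|ᵥ} / max{|x|ᵥ⁴, 1} ≤ c₂` for all `x ∈ K` (ATAEC, proof of Lemma VI.1.2;
compare `WeierstrassCurve.Affine.Point.exists_bounds_duplication_quotient`, which assumes `2 ≠ 0`).
[cite: Silverman1994, Lemma VI.1.2] -/
theorem exists_duplication_quotient_bounds [W.IsElliptic] :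
    ∃ c₁ c₂ : ℝ, 0 < c₁ ∧ c₁ ≤ c₂ ∧ ∀ x : K,
      c₁ ≤ max (v ((W.Φ 2).eval x)) (v (W.Ψ₂Sq.eval x)) / max (v x ^ 4) 1 ∧
        max (v ((W.Φ 2).eval x)) (v (W.Ψ₂Sq.eval x)) / max (v x ^ 4) 1 ≤ c₂ := by
  obtain ⟨c, hc, hlow⟩ := exists_pos_mul_le_max_abv_duplication v W
  set cφ := 1 + v W.b₄ + v (2 * W.b₆) + v W.b₈ with hcφ
  set cf := v 4 + v W.b₂ + v (2 * W.b₄) + v W.b₆ with hcf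
  have hcφ0 : 0 ≤ cφ := by positivity
  have hcf0 : 0 ≤ cf := by positivity
  refine ⟨c, max (cφ + cf) c, hc, le_max_right _ _, fun x => ?_⟩
  have hlo := hlow x
  have hφ := abv_eval_Φ_two_le v W x
  have hf := abv_eval_Ψ₂Sq_le v W x
  rw [← hcφ] at hφ
  rw [← hcf] at hf
  set m := max (v x) 1 with hm
  have hm1 : 1 ≤ m := le_max_right _ _
  have hm0 : 0 < m := by positivity
  have hm4 : max (v x ^ 4) 1 = m ^ 4 := by
    rcases le_total (v x) 1 with h | h
    · rw [hm, max_eq_right h, one_pow, max_eq_right (pow_le_one₀ (v.nonneg x) h)]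
    · rw [hm, max_eq_left h, max_eq_left (one_le_pow₀ h)]
  set M := max (v ((W.Φ 2).eval x)) (v (W.Ψ₂Sq.eval x)) with hM
  have hM0 : 0 ≤ M := le_max_of_le_left (v.nonneg _)
  rw [hm4]
  have hm4pos : 0 < m ^ 4 := by positivity
  constructor
  · rw [le_div_iff₀ hm4pos]
    exact hlo
  · rw [div_le_iff₀ hm4pos]
    have hf' : v (W.Ψ₂Sq.eval x) ≤ cf * m ^ 4 :=
      hf.trans (mul_le_mul_of_nonneg_left (pow_le_pow_right₀ hm1 (by norm_num)) hcf0)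
    calc M ≤ cφ * m ^ 4 + cf * m ^ 4 := max_le (by nlinarith) (by nlinarith)
      _ = (cφ + cf) * m ^ 4 := by ring
      _ ≤ max (cφ + cf) c * m ^ 4 := by gcongr; exact le_max_left _ _

end Estimates

end Literature.NumberTheory.EllipticCurves

/-! ### The discharges: ATAEC Lemma VI.1.2 and Thm. VI.1.1(a)(iii), unconditionally -/

namespace WeierstrassCurve.Affine.Point

open Literature.NumberTheory.EllipticCurves

variable {K : Type*} [Field K] (v : AbsoluteValue K ℝ) (W : WeierstrassCurve K)

/-- **Tate's Lemma (ATAEC Lemma VI.1.2), discharged in every characteristic**: for an elliptic curve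
`W` over any field `K` and any absolute value `v` on `K`, Tate's correction term
`f(P) = ½ log (max{|φ(x)|ᵥ, |ψ(x)|ᵥ} / max{|x|ᵥ⁴, 1}) − ¼ log|Δ|ᵥ` (extended by `f(O) = −¼ log|Δ|ᵥ`)
is bounded on `E(K)`: *"f extends to a bounded continuous function on all of E(K)"* (the boundedness
clause, which is the content of the named fact `tateCorrection_bounded`). Proof as printed (p. 457),
with the coprimality of `φ, ψ` certified by Stoll's `addSubMapCoeff_condition`
(`exists_duplication_quotient_bounds`). (Deliberate dot-notation extension of Mathlib's
`WeierstrassCurve.Affine.Point`, matching the fact it discharges.) [cite: Silverman1994, Lemma VI.1.2] -/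
theorem tateCorrection_bounded_holds : tateCorrection_bounded v W := by
  intro _
  obtain ⟨c₁, c₂, hc₁, hc₁₂, hb⟩ := exists_duplication_quotient_bounds v W
  set C₀ := max |Real.log c₁| |Real.log c₂| with hC₀
  refine ⟨1 / 2 * C₀ + |1 / 4 * Real.log (v W.Δ)|, fun P => ?_⟩
  have hC₀0 : 0 ≤ C₀ := le_max_of_le_left (abs_nonneg _)
  cases P with
  | zero =>
    rw [← WeierstrassCurve.Affine.Point.zero_def, tateCorrection_zero, abs_neg]
    linarith [abs_nonneg (1 / 4 * Real.log (v W.Δ))]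
  | some x y h =>
    rw [tateCorrection_some]
    obtain ⟨hlo, hhi⟩ := hb x
    set ρ := max (v ((W.Φ 2).eval x)) (v (W.Ψ₂Sq.eval x)) / max (v x ^ 4) 1 with hρ
    have hρ0 : 0 < ρ := hc₁.trans_le hlo
    have hlog : |Real.log ρ| ≤ C₀ := by
      rw [abs_le]
      constructor
      · have := Real.log_le_log hc₁ hlo
        have h1 : -|Real.log c₁| ≤ Real.log c₁ := neg_abs_le _
        linarith [le_max_left |Real.log c₁| |Real.log c₂|]
      · have := Real.log_le_log hρ0 hhi
        linarith [le_abs_self (Real.log c₂), le_max_right |Real.log c₁| |Real.log c₂|]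
    calc |1 / 2 * Real.log ρ - 1 / 4 * Real.log (v W.Δ)|
        ≤ |1 / 2 * Real.log ρ| + |1 / 4 * Real.log (v W.Δ)| := abs_sub _ _
      _ ≤ 1 / 2 * C₀ + |1 / 4 * Real.log (v W.Δ)| := by
          gcongr
          rw [abs_mul, abs_of_pos (by norm_num : (0 : ℝ) < 1 / 2)]
          gcongr

/-- **ATAEC Thm. VI.1.1(a)(iii), discharged** (Néron, Tate; p. 455, proof p. 458): for an elliptic
curve `W` over any field `K`, any absolute value `v`, and every `P = (x, y) ∈ E(K)` with `[2]P ≠ O`,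
`λ([2]P) = 4λ(P) + v((2y + a₁x + a₃)(P)) − ¼ v(Δ)`, i.e.
`λ(2P) = 4λ(P) − log|2y + a₁x + a₃|ᵥ + ¼ log|Δ|ᵥ`, for Tate's `λ = λ₁ + μ` (`neronLocalHeight`).
From Lemma VI.1.2 (`tateCorrection_bounded_holds`) through the tree's
`neronLocalHeight_two_nsmul_of` (telescoping identity of Prop. VI.1.3 and `x(2P) = φ/ψ`).
[cite: Silverman1994, Thm VI.1.1(a)(iii)] -/
theorem neronLocalHeight_two_nsmul_holds : neronLocalHeight_two_nsmul v W :=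
  neronLocalHeight_two_nsmul_of v (tateCorrection_bounded_holds v W)

/-! ### Unconditional forms of the conditional API of `NeronLocalHeight.lean` -/

/-- Lemma VI.1.2 as an existential: `∃ C, ∀ P, |f(P)| ≤ C`. [cite: Silverman1994, Lemma VI.1.2] -/
theorem exists_abs_tateCorrection_le [W.IsElliptic] :
    ∃ C : ℝ, ∀ P : W.toAffine.Point, |tateCorrection v P| ≤ C :=
  tateCorrection_bounded_holds v W

/-- Tate's series `μ(P) = Σ 4^{-(n+1)} f(2ⁿP)` converges absolutely (ATAEC, proof of Prop. VI.1.3),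
unconditionally. [cite: Silverman1994, Prop VI.1.3] -/
theorem summable_tateMu [W.IsElliptic] (P : W.toAffine.Point) :
    Summable fun n : ℕ => (1 / 4 : ℝ) ^ (n + 1) * tateCorrection v ((2 ^ n) • P) :=
  summable_tateMu_of v (tateCorrection_bounded_holds v W) P

/-- **ATAEC Prop. VI.1.3** (Tate's telescoping identity) for Tate's `μ`, unconditionally:
`4μ(P) − μ([2]P) = f(P)` for every `P ∈ E(K)`. [cite: Silverman1994, Prop VI.1.3] -/
theorem four_mul_tateMu_sub_tateMu_two_nsmul [W.IsElliptic] (P : W.toAffine.Point) :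
    4 * tateMu v P - tateMu v ((2 : ℕ) • P) = tateCorrection v P :=
  four_mul_tateMu_sub_tateMu_two_nsmul_of v (tateCorrection_bounded_holds v W) P

/-- **ATAEC Thm. VI.1.1(a)(i)–(ii) in quantitative form, unconditionally**: `λ − λ₁` is bounded on
`E(K)`, i.e. `|λ(P) − ½ log⁺|x(P)|ᵥ| ≤ C` for all `P` (so `λ` is bounded away from `O` and
`λ + ½ v(x)` has a limit at `O`); this is the local inequality
`−c_v ≤ λ_v − ½ max{v(x⁻¹), 0} ≤ c_v` used in the proof of Thm. VI.2.1. [cite: Silverman1994, Thm VI.1.1(a)] -/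
theorem exists_abs_neronLocalHeight_sub_naiveLocalHeight_le [W.IsElliptic] :
    ∃ C : ℝ, ∀ P : W.toAffine.Point, |neronLocalHeight v P - naiveLocalHeight v P| ≤ C := by
  obtain ⟨C, hC⟩ := exists_abs_tateCorrection_le v W
  exact ⟨C / 3, abs_neronLocalHeight_sub_naiveLocalHeight_le_of v hC⟩

/-- The duplication formula of Thm. VI.1.1(a)(iii) as a rewriting lemma: for `P = (x, y)` with
`[2]P ≠ O`, `λ(2P) = 4λ(P) − log|2y + a₁x + a₃|ᵥ + ¼ log|Δ|ᵥ`. [cite: Silverman1994, Thm VI.1.1(a)(iii)] -/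
theorem neronLocalHeight_two_nsmul_eq [W.IsElliptic] {x y : K} (h : W.toAffine.Nonsingular x y)
    (h2 : (2 : ℕ) • some x y h ≠ 0) :
    neronLocalHeight v ((2 : ℕ) • some x y h) =
      4 * neronLocalHeight v (some x y h) - Real.log (v (2 * y + W.a₁ * x + W.a₃)) +
        1 / 4 * Real.log (v W.Δ) :=
  neronLocalHeight_two_nsmul_holds v W h h2

end WeierstrassCurve.Affine.Point

end
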